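import Literature.MathematicalPhysics.QuantumFieldTheory.Balaban1983to89.B9LettersZCFieldsAtPins

/-!
# `Balaban1983to89.B9LettersZCFieldsAtPinsB` — [B9] Theorems 3.12–3.13 (pp. 420–426): the (3.132) CLASS LETTERS `c2` (C = (QGQ\*)⁻¹), `c1_2 = c12` and `c1_1`
# (C₁ = (QG₁Q\*)⁻¹) of the rows-20–21 Z-schemas AT THE PINS OVER AN ARBITRARY BACKGROUND CARRIER, MEMBER-UNIFORMLY FROM ROW 26's PRINTED STATEMENT — with the
# threshold, rate and constant PRODUCED (not prescribed)

T. Bałaban, *Propagators for lattice gauge theories in a background field*, Commun. Math. Phys. **99** (1985) 389–434 [`Balaban1985BackgroundPropagators`, "B9"];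
[4] = T. Bałaban, *Propagators and renormalization transformations for lattice gauge theories. II*, Commun. Math. Phys. **96** (1984) 223–250 [`Balaban1984PropagatorsII`].

statement-level skeleton of published theorems with citation tags; proofs where landed; nothing here is a claim about the Yang–Mills mass gap

THE PRINT.  p. 422: *«The operators (QG̃Q\*)⁻¹, or (QG₁Q\*)⁻¹, can be analyzed in the same way as the operator (Q′G′²Q′\*)⁻¹ … let us write only bounds. We have
|(QG̃Q\*)⁻¹(y,y′)| ≤ O(1)(Lʲη)⁻²(L^{j′}η)^{−d}e^{−δ₁d(y,y′)} … (3.132)»*; p. 398 (remark after (3.47)): *«the powers of Lʲη may be moved»* ([4] Lemma 2.1 (2.60)).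

WHY (cell `pub-ymgap`, node N06, bundle F7 rows 20–21, seat dag-n06-l g30; memo `DISPLAY-LEDGER-ROWS2021.md` §2 row 4).  The N06 certificate of record (ED.77 «UD»)
DERIVES row 26 — `s3132 : B9.Stmt3132Printed (d+1) c35 geo9Y (bg9YR … R₁ R₂) (ν-reading of (QGQ\*)⁻¹) (ν-reading of (QG₁Q\*)⁻¹)` — from the regular state by
Combes–Thomas (`B9Eq3132FromStateR`), with the rate PRODUCED; yet rows 20–21 still DISPLAY the same content as four class letters `hlettersH12`.c2∕.c12, `hZ8`.5∕.6
at the letters' common rate δ12₃, which the U8 budget pins above the state rate — so the certificate's own (3.132) can never feed them.  dag-n06-w5's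
`B9LettersZCFieldsAtPins.c2_pins ∕ c12_pins ∕ c2_c12_pins_of_row26` turn row 26's statement into exactly these class letters, but at the member carrier `bg9Y … x`
and through [4] (2.60) at a FIXED exponent (`Facts347`) for `c1_1`.  THIS FILE: (§1) the p.-398 transfer for a weighted coarse target at an M-THRESHOLD (the (2.60)
cost `ε` is free, the threshold `log L ∕ ε` pays — dag-n06-w3's `len_pow_le_of_transfer`), hence `c1_1` from `c1_2` losing only a chosen `ε`; (§2) `c2_pinsB ∕ c12_pinsB` =
w5's per-member theorems over ANY carrier `B` with configuration map `cfg` (the cores `hasMaj_cNorm_weightNorm_coordOpK_geo9Y_of_ineq3132Nu` are already carrier-generic);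
(§3) ★★★ `c_letters_of_row26B` — from `B9.Stmt3132Printed (d+1) c35 geo9Y bg (ν-readings of QGQinvY ∕ QG1QinvY at cfg)` (at the certificate: ITS `s3132`, the kernels
agree by `rfl`) ONE `obtain` gives `M₄ δC a₀ BC > 0` and, for every member above `M₄`, every `0 < α₀ ≤ a₀∕M`, every `U` in the carrier's two classes, the THREE letters
`C : 𝔠_Z⁽²⁾ → Z_{n⁻¹}`, `C₁ : 𝔠_Z⁽²⁾ → Z_{n⁻¹}`, `C₁ : 𝔠_Z⁽¹⁾ → Z_{len·n⁻¹}` with the COMMON majorant `BC·e^{−δC d}` (`δC = δ₁∕4`: one halving in the class reading,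
one in the transfer).  A consumer runs rows 20–21 at a master rate chosen AFTER `δC` (the leaves' budgets are homogeneous; `Thm312∕313Printed` are ∃-rated).
HONEST SCOPE.  Kinematic∕bookkeeping compositions; row 26's statement is the HYPOTHESIS; nothing of [B9]'s Theorems 3.3 ∕ 3.11 ∕ 3.12 ∕ 3.13 is asserted; COUNT-NEUTRAL;
N06 NOT discharged; one finite lattice at a time; nothing continuum, nothing about the mass gap ∕ Clay.  NEW file; w5's file untouched.
-/

noncomputable section

namespace Literature.MathematicalPhysics.QuantumFieldTheory.Balaban1983to89.B9LettersZCFieldsAtPinsB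

open scoped Matrix.Norms.L2Operator
open Node00 B6GlobalChartV1 B6KLevelCensusIndexV1
open B6RandomWalk (HasMajorant)
open B7Prop2SpecialUnitary (specialUnitaryUnits)
open B9PinMembersKLevelV1 (MemberY geo9Y bg9Y)
open B6Ineq2142KLevelV1 (β lvl)
open B9CoReadingCoordsTranspose (TrIdx trBasis)
open B9CoReadingCoordsH (XHK blkHK)
open B9GeoNormsKLevelV1 (geo9K geo9K_dist_nonneg)
open B9GeoLemma21KLevelV1 (geo9Y_dist_triangle geo9Y_dist_comm geo9Y_len_pos geo9K_one_le_L)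
open B9Thm34Ext (toB6)
open B9SectDSup (weightNorm weightNorm_loc)
open B11SectG (HasMaj BlockNorm)
open B9Thm312Whole (Ops GeoOK cNorm)
open B9Thm312WholeClasses (cNormR cNormR_loc cNormR_loc_neg_natCast)
open B9PerturbationMajorantAlgebra (hasMaj_weaken)
open Node00.OpsYSectDCoords (CcoK C1coK)
open B9Eq3132SectDLetters (QGQinvY)
open B9Eq3132NuReading (siteKernelOfOpNu nuY)
open B9Eq3132ClassLetterFromNu (hasMaj_cNorm_weightNorm_coordOpK_geo9Y_of_ineq3132Nu)
open B9Thm39ReadingCoords (cR39 cR39_nonneg coordBound39 basisBound39 abs_repr_le)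
open B9Letters313AtOneQ (len_pow_le_of_transfer)
open B9LettersZCFieldsAtPins (const3132_le)

variable {d ℓ : ℕ} {hd : 1 ≤ d + 1} {hL : Odd (ℓ + 1) ∧ 1 < ℓ + 1} {b₀ b₁ : ℝ}

/-! ## §1 p. 398's transfer for a weighted coarse target at an M-threshold; `c1_1` from `c1_2` losing a chosen `ε` -/

section Transfer

variable (i : KIdx d ℓ hd hL b₀ b₁) [Fintype (geo9K i).Site] {V Z : Type} [Fintype V] [Fintype Z] {R₀ : ℝ} {H₀ : Prop}

/-- ★ **p. 398's TRANSFER FOR A WEIGHTED COARSE TARGET, THRESHOLD FORM** (dag-n06-w5's `hasMaj_shift_weight_target` with [4] (2.60) at a free rate `ε`): above the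
member threshold `log L ≤ ε(2L²−1)M` a majorant `C·e^{−rd}` of `T : 𝔠^{(s)} → Z_w` is the majorant `C·L·e^{−(r−ε)d}` of `T : 𝔠^{(s+1)} → Z_{len·w}`.
[cite: Balaban1985BackgroundPropagators, p.398 (remark after (3.47)); Balaban1984PropagatorsII, Lemma 2.1 (2.60) p.234 with (2.88) p.238] -/
theorem hasMaj_shift_weight_target_transfer (hG : GeoOK (geo9K i)) {ε : ℝ} (hε : 0 < ε)
    (hM : (1 : ℝ) * Real.log (geo9K i).L ≤ ε * (2 * ((ℓ : ℝ) + 1) ^ 2 - 1) * (geo9K i).M)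
    {blkV : V → (geo9K i).Site} {blkZ : Z → (geo9K i).Site} {w : (geo9K i).Site → ℝ} (hw : ∀ y, 0 ≤ w y) (hw' : ∀ y, 0 ≤ (geo9K i).len y * w y)
    {T : (V → ℝ) →ₗ[ℝ] (Z → ℝ)} {C r s : ℝ} (hC : 0 ≤ C)
    (h : HasMaj (cNormR R₀ H₀ blkV hG.lenle s) (weightNorm (BlockNorm.ofBlocks (toB6 (geo9K i) R₀ H₀) blkZ) w hw) T
      (fun a b => C * Real.exp (-(r * (geo9K i).dist a b)))) :
    HasMaj (cNormR R₀ H₀ blkV hG.lenle (s + 1)) (weightNorm (BlockNorm.ofBlocks (toB6 (geo9K i) R₀ H₀) blkZ) (fun y => (geo9K i).len y * w y) hw') T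
      (fun a b => C * (geo9K i).L * Real.exp (-((r - ε) * (geo9K i).dist a b))) := by
  intro y' μ hμ y
  have hb := h y' μ hμ y
  simp only [weightNorm_loc, cNormR_loc] at hb
  simp only [weightNorm_loc, cNormR_loc]
  rw [Real.rpow_add (hG.lenpos y'), Real.rpow_one]
  set N := (BlockNorm.ofBlocks (toB6 (geo9K i) R₀ H₀) blkZ).loc y (T μ) with hN
  set N' := (BlockNorm.ofBlocks (toB6 (geo9K i) R₀ H₀) blkV).loc y' μ with hN'
  have hN'0 : 0 ≤ N' := (BlockNorm.ofBlocks (toB6 (geo9K i) R₀ H₀) blkV).loc_nonneg y' μ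
  have hsN : 0 ≤ (geo9K i).len y' ^ s * N' := mul_nonneg (Real.rpow_nonneg (hG.lenle y') s) hN'0
  -- the transfer at (y′, y): e^{−εd(y,y′)}·Lʲη ≦ L·L^{j′}η, from `len_pow_le_of_transfer` at p = 1
  have hst : Real.exp (-(ε * (geo9K i).dist y y')) * (geo9K i).len y ≤ (geo9K i).L * (geo9K i).len y' := by
    have h1 := len_pow_le_of_transfer i hε 1 (by simpa only [Nat.cast_one] using hM) y' y
    simp only [pow_one] at h1
    rw [hG.symm y' y] at h1
    have he : 0 < Real.exp (ε * (geo9K i).dist y y') := Real.exp_pos _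
    rw [Real.exp_neg, inv_mul_le_iff₀ he]
    calc (geo9K i).len y ≤ (geo9K i).L * Real.exp (ε * (geo9K i).dist y y') * (geo9K i).len y' := h1
      _ = Real.exp (ε * (geo9K i).dist y y') * ((geo9K i).L * (geo9K i).len y') := by ring
  have hsplit : Real.exp (-(r * (geo9K i).dist y y')) =
      Real.exp (-((r - ε) * (geo9K i).dist y y')) * Real.exp (-(ε * (geo9K i).dist y y')) := by
    rw [← Real.exp_add]; congr 1; ring
  have hE : 0 ≤ C * Real.exp (-((r - ε) * (geo9K i).dist y y')) := mul_nonneg hC (Real.exp_nonneg _)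
  calc (geo9K i).len y * w y * N = (geo9K i).len y * (w y * N) := by ring
    _ ≤ (geo9K i).len y * (C * Real.exp (-(r * (geo9K i).dist y y')) * ((geo9K i).len y' ^ s * N')) := mul_le_mul_of_nonneg_left hb (hG.lenle y)
    _ = C * Real.exp (-((r - ε) * (geo9K i).dist y y')) * (Real.exp (-(ε * (geo9K i).dist y y')) * (geo9K i).len y) * ((geo9K i).len y' ^ s * N') := by
        rw [hsplit]; ring
    _ ≤ C * Real.exp (-((r - ε) * (geo9K i).dist y y')) * ((geo9K i).L * (geo9K i).len y') * ((geo9K i).len y' ^ s * N') :=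
        mul_le_mul_of_nonneg_right (mul_le_mul_of_nonneg_left hst hE) hsN
    _ = C * (geo9K i).L * Real.exp (-((r - ε) * (geo9K i).dist y y')) * ((geo9K i).len y' ^ s * (geo9K i).len y' * N') := by ring

/-- ★★ **`c1_1` FROM `c1_2`, THRESHOLD FORM** — `C₁ : 𝔠_Z⁽¹⁾ → Z_{len·w}` with `B₃′·e^{−δ₃′d}` from `C₁ : 𝔠_Z⁽²⁾ → Z_w` with `B₃·e^{−δ₃d}`, for any `B₃′ ≥ B₃·L`,
`δ₃′ ≤ δ₃ − ε`, `0 < ε`, above the member threshold `log L ≤ ε(2L²−1)M` (w5's `c1_1_of_c1_2` with the fixed-exponent `Facts347` replaced by the threshold transfer).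
[cite: Balaban1985BackgroundPropagators, (3.132) p.422 + Thm 3.13 p.426 + p.398 (remark after (3.47)); Balaban1984PropagatorsII, (2.51) p.232 + Lemma 2.1 (2.60) p.234] -/
theorem c1_1_of_c1_2_transfer (hG : GeoOK (geo9K i)) {ε : ℝ} (hε : 0 < ε)
    (hM : (1 : ℝ) * Real.log (geo9K i).L ≤ ε * (2 * ((ℓ : ℝ) + 1) ^ 2 - 1) * (geo9K i).M)
    {blkZ : Z → (geo9K i).Site} {wZ : (geo9K i).Site → ℝ} (hwZ : ∀ y, 0 < wZ y) (hwZ' : ∀ y, 0 ≤ (geo9K i).len y * wZ y)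
    {Cop : Module.End ℝ (Z → ℝ)} {B₃ δ₃ B₃' δ₃' : ℝ} (hB₃ : 0 ≤ B₃) (hB' : B₃ * (geo9K i).L ≤ B₃') (hδ' : δ₃' ≤ δ₃ - ε)
    (h : HasMaj (cNorm R₀ H₀ blkZ hG.lenle 2) (weightNorm (BlockNorm.ofBlocks (toB6 (geo9K i) R₀ H₀) blkZ) wZ fun y => (hwZ y).le) Cop
      (fun a b => B₃ * Real.exp (-(δ₃ * (geo9K i).dist a b)))) :
    HasMaj (cNorm R₀ H₀ blkZ hG.lenle 1) (weightNorm (BlockNorm.ofBlocks (toB6 (geo9K i) R₀ H₀) blkZ) (fun y => (geo9K i).len y * wZ y) hwZ') Cop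
      (fun a b => B₃' * Real.exp (-(δ₃' * (geo9K i).dist a b))) := by
  have h2R : HasMaj (cNormR R₀ H₀ blkZ hG.lenle (-2)) (weightNorm (BlockNorm.ofBlocks (toB6 (geo9K i) R₀ H₀) blkZ) wZ fun y => (hwZ y).le) Cop
      (fun a b => B₃ * Real.exp (-(δ₃ * (geo9K i).dist a b))) := by
    intro y' μ hμ y
    have e : (cNormR R₀ H₀ blkZ hG.lenle (-2)).loc y' μ = (cNorm R₀ H₀ blkZ hG.lenle 2).loc y' μ := by
      have h0 := cNormR_loc_neg_natCast (R₀ := R₀) (H₀ := H₀) hG blkZ 2 y' μ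
      simpa only [Nat.cast_ofNat] using h0
    rw [e]
    exact h y' μ hμ y
  have h1R := hasMaj_shift_weight_target_transfer i hG hε hM (fun y => (hwZ y).le) hwZ' hB₃ h2R
  have h1R' : HasMaj (cNormR R₀ H₀ blkZ hG.lenle (-((1 : ℕ) : ℝ)))
      (weightNorm (BlockNorm.ofBlocks (toB6 (geo9K i) R₀ H₀) blkZ) (fun y => (geo9K i).len y * wZ y) hwZ') Cop
      (fun a b => B₃ * (geo9K i).L * Real.exp (-((δ₃ - ε) * (geo9K i).dist a b))) := by
    refine fun y' μ hμ y => (h1R y' μ hμ y).trans_eq ?_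
    norm_num
  have hL₀ : 0 ≤ (geo9K i).L := zero_le_one.trans (geo9K_one_le_L i)
  have hw1 := hasMaj_weaken hG (mul_nonneg hB₃ hL₀) hB' hδ' h1R'
  intro y' μ hμ y
  have hb := hw1 y' μ hμ y
  rw [cNormR_loc_neg_natCast hG] at hb
  exact hb

end Transfer

/-! ## §2 The per-member class letters `c2 ∕ c12` at the pins over any carrier -/

section Pins

variable {Mstar : ℕ} {N : ℕ}
variable [∀ x : MemberY d ℓ hd hL b₀ b₁ Mstar, Fintype (geo9Y x).Site]

/-- ★★ **`LettersHZ.c2` AT THE PINS FROM ROW 26's (3.132) KERNEL FOR `C = (QGQ\*)⁻¹`** — every member above the transfer threshold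
`2·log L ≤ (δ₁ − δ₃)·(2L² − 1)·M`, every `U`: with `𝔬.C U` pinned to node00-def-Y's `CcoK` over the symmetrised tables and `G′ = GpPhysY` (`hC`, the
certificate's `hCco12`; ANY background carrier `B` with configuration map `cfg`) and `𝔬.blkZ = blkHK` (`hblkZ`, the certificate's `hblkZ12`), the per-member conjunct `Ineq3132 (d+1) kerν C δ₁ U` of row 26's
`B9.Stmt3132Printed` for the `ν`-read kernel of `(QGQ\*)⁻¹[G′_phys]` (`h26` — HYPOTHESIS, row 26's content; at the certificate's instance of record it is the
first conjunct by def-Y's `opsYNuOfRecordV4PE_QGQinv_QG1Qinv`, `rfl`) gives the class letter `C : 𝔠_Z⁽²⁾ → Z_{n⁻¹}` with `B₃·e^{−δ₃d}` for any `δ₃ < δ₁` and any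
`B₃ ≥ cR39·coordBound39·basisBound39·C·(ℓ+1)²` — dag-n06-i's `hasMaj_cNorm_weightNorm_coordOpK_geo9Y_of_ineq3132Nu` at `b := trBasis N`, `c := cR39 b`,
`O := QGQinvY …`, read through the pins.
[cite: Balaban1985BackgroundPropagators, (3.132) p.422 + (3.123) p.420 + (3.42) p.397 + p.398 (remark after (3.47)); Balaban1984PropagatorsII, (2.51) p.232 + Lemma 2.1 (2.60) p.234] -/
theorem c2_pinsB (x : MemberY d ℓ hd hL b₀ b₁ Mstar) {X Y W : Type} [Fintype X] [Fintype Y] [Fintype W]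
    {B : B9.Backgrounds} {cfg : B.Cfg → CfgY (Matrix (Fin N) (Fin N) ℂ) x.toKIdx}
    {𝔬 : Ops (geo9Y x) B X Y (XHK (TrIdx N) x.toKIdx) W}
    {H : Prop} {U : B.Cfg} {C δ₁ δ₃ B₃ : ℝ} (hC : 0 ≤ C) (hδ : δ₃ < δ₁)
    (hM : 2 * Real.log (((ℓ + 1 : ℕ) : ℝ)) ≤ (δ₁ - δ₃) * (2 * ((ℓ : ℝ) + 1) ^ 2 - 1) * (geo9Y x).M)
    (hB₃ : cR39 (trBasis N) * (coordBound39 (trBasis N) * basisBound39 (trBasis N)) * C * (((ℓ + 1 : ℕ) : ℝ)) ^ 2 ≤ B₃)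
    (hblkZ : 𝔬.blkZ = blkHK x.toKIdx)
    (hCop : 𝔬.C U = CcoK x.toKIdx (trBasis N) B cfg
      (parSymY x.toKIdx) (parBY x.toKIdx) (GpPhysY x.toKIdx (parSymY x.toKIdx)) U)
    (hpl : ∀ y : (geo9Y x).Site, 0 ≤ ((((ℓ + 1 : ℕ) : ℝ) ^ (d + 1)) ^ lvl x.hN x.D x.hk y)⁻¹)
    (h26 : B9.Ineq3132 (d + 1)
      (siteKernelOfOpNu x.toKIdx B cfg (nuY (d + 1) x.toKIdx)
        (QGQinvY x.toKIdx (parSymY x.toKIdx) (parBY x.toKIdx) (GpPhysY x.toKIdx (parSymY x.toKIdx)))) C δ₁ U) :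
    HasMaj (cNorm 1 H 𝔬.blkZ (fun y => (geo9Y_len_pos x y).le) 2)
      (weightNorm (BlockNorm.ofBlocks (toB6 (geo9Y x) 1 H) 𝔬.blkZ) (fun y => ((((ℓ + 1 : ℕ) : ℝ) ^ (d + 1)) ^ lvl x.hN x.D x.hk y)⁻¹) hpl)
      (𝔬.C U) (fun a b => B₃ * Real.exp (-(δ₃ * (geo9Y x).dist a b))) := by
  have h := hasMaj_cNorm_weightNorm_coordOpK_geo9Y_of_ineq3132Nu (trBasis N) x B cfg
    (QGQinvY x.toKIdx (parSymY x.toKIdx) (parBY x.toKIdx) (GpPhysY x.toKIdx (parSymY x.toKIdx)))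
    (norm_nonneg _) (abs_repr_le (trBasis N)) 1 H (cR39 (trBasis N)) U (fun y => (geo9Y_len_pos x y).le) hpl hC hδ hM h26
  rw [hblkZ, hCop]
  exact h.mono fun a b' => mul_le_mul_of_nonneg_right (const3132_le hB₃) (Real.exp_nonneg _)

/-- ★★ **`LettersHZ.c12` = `Letters313Z(c).c1_2` AT THE PINS FROM ROW 26's (3.132) KERNEL FOR `C₁ = (QG₁Q\*)⁻¹`** — the same for the second conjunct of
row 26 (`h26₁`, the `ν`-read kernel of `(QG₁Q\*)⁻¹[G′_phys, Δ⁽²⁾]`) and the pin `hC1` (the certificate's `hC1co12`, residual `Δ⁽²⁾ = (𝔯 x).Δ2`).  Its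
consequences `c1_1 ∕ c1` (block-L²) are §1–§3 (`c1_1_of_c1_2`, `c1_l2_pins`).
[cite: Balaban1985BackgroundPropagators, (3.132) p.422 + (3.129) p.421 + (3.42) p.397 + p.398 (remark after (3.47)); Balaban1984PropagatorsII, (2.51) p.232 + Lemma 2.1 (2.60) p.234] -/
theorem c12_pinsB (x : MemberY d ℓ hd hL b₀ b₁ Mstar) {X Y W : Type} [Fintype X] [Fintype Y] [Fintype W]
    {B : B9.Backgrounds} {cfg : B.Cfg → CfgY (Matrix (Fin N) (Fin N) ℂ) x.toKIdx}
    {𝔬 : Ops (geo9Y x) B X Y (XHK (TrIdx N) x.toKIdx) W}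
    {H : Prop} {Δ2 : BondOpY (Matrix (Fin N) (Fin N) ℂ) x.toKIdx}
    {U : B.Cfg} {C δ₁ δ₃ B₃ : ℝ} (hC : 0 ≤ C) (hδ : δ₃ < δ₁)
    (hM : 2 * Real.log (((ℓ + 1 : ℕ) : ℝ)) ≤ (δ₁ - δ₃) * (2 * ((ℓ : ℝ) + 1) ^ 2 - 1) * (geo9Y x).M)
    (hB₃ : cR39 (trBasis N) * (coordBound39 (trBasis N) * basisBound39 (trBasis N)) * C * (((ℓ + 1 : ℕ) : ℝ)) ^ 2 ≤ B₃)
    (hblkZ : 𝔬.blkZ = blkHK x.toKIdx)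
    (hC1 : 𝔬.C1 U = C1coK x.toKIdx (trBasis N) B cfg
      (parSymY x.toKIdx) (parBY x.toKIdx) (GpPhysY x.toKIdx (parSymY x.toKIdx)) Δ2 U)
    (hpl : ∀ y : (geo9Y x).Site, 0 ≤ ((((ℓ + 1 : ℕ) : ℝ) ^ (d + 1)) ^ lvl x.hN x.D x.hk y)⁻¹)
    (h26₁ : B9.Ineq3132 (d + 1)
      (siteKernelOfOpNu x.toKIdx B cfg (nuY (d + 1) x.toKIdx)
        (QG1QinvY x.toKIdx (parSymY x.toKIdx) (parBY x.toKIdx) (GpPhysY x.toKIdx (parSymY x.toKIdx)) Δ2)) C δ₁ U) :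
    HasMaj (cNorm 1 H 𝔬.blkZ (fun y => (geo9Y_len_pos x y).le) 2)
      (weightNorm (BlockNorm.ofBlocks (toB6 (geo9Y x) 1 H) 𝔬.blkZ) (fun y => ((((ℓ + 1 : ℕ) : ℝ) ^ (d + 1)) ^ lvl x.hN x.D x.hk y)⁻¹) hpl)
      (𝔬.C1 U) (fun a b => B₃ * Real.exp (-(δ₃ * (geo9Y x).dist a b))) := by
  have h := hasMaj_cNorm_weightNorm_coordOpK_geo9Y_of_ineq3132Nu (trBasis N) x B cfg
    (QG1QinvY x.toKIdx (parSymY x.toKIdx) (parBY x.toKIdx) (GpPhysY x.toKIdx (parSymY x.toKIdx)) Δ2)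
    (norm_nonneg _) (abs_repr_le (trBasis N)) 1 H (cR39 (trBasis N)) U (fun y => (geo9Y_len_pos x y).le) hpl hC hδ hM h26₁
  rw [hblkZ, hC1]
  exact h.mono fun a b' => mul_le_mul_of_nonneg_right (const3132_le hB₃) (Real.exp_nonneg _)


end Pins

/-! ## §3 Member-uniformly from ROW 26's printed statement: the three class letters with PRODUCED threshold, rate and constant -/

section Family

variable {Mstar : ℕ} {N : ℕ}
variable [∀ x : MemberY d ℓ hd hL b₀ b₁ Mstar, Fintype (geo9Y x).Site]

/-- ★★★ **ROW 26 ⟹ THE THREE (3.132) CLASS LETTERS OF ROWS 20–21, MEMBER-UNIFORMLY, OVER ANY CARRIER** — from `B9.Stmt3132Printed (d+1) c35 geo9Y bg (ν-reading of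
(QGQ\*)⁻¹[G′_phys] at cfg) (ν-reading of (QG₁Q\*)⁻¹[G′_phys, Δ⁽²⁾] at cfg)` (HYPOTHESIS — row 26's content; at the N06 certificate of record it is ITS OWN derived `s3132`,
the kernels agreeing by `rfl`) ONE `obtain` gives `M₄, δC, a₀, BC > 0` such that every member with `M₄ ≤ M`, every `0 < α₀` with `M·α₀ ≤ a₀` and every `U` in the
carrier's classes (3.35)–(3.36) carry, at the pins `hblkZ ∕ hC ∕ hC1` (the certificate's `hblkZ12 ∕ hCco12 ∕ hC1co12`), the letters `LettersHZ.c2` (`C : 𝔠_Z⁽²⁾ → Z_{n⁻¹}`),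
`LettersHZ.c12 = Letters313Zc.c1_2` (`C₁ : 𝔠_Z⁽²⁾ → Z_{n⁻¹}`) and `Letters313Zc.c1_1` (`C₁ : 𝔠_Z⁽¹⁾ → Z_{len·n⁻¹}`) with the COMMON majorant `BC·e^{−δC d}`
(`δC = δ₁∕4`, `δ₁` the produced rate of row 26: one halving in the class reading of the `ν`-kernel, one in the p.-398 transfer; thresholds `2·log L∕((δ₁∕2)(2L²−1))`,
`log L∕((δ₁∕4)(2L²−1))` absorbed into `M₄`).  The rate is PRODUCED, not prescribed: a consumer runs rows 20–21 at a master rate chosen after `δC`.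
[cite: Balaban1985BackgroundPropagators, (3.132) p.422 (statement before Thm 3.12) + (3.123) p.420 + (3.129) p.421 + Thm 3.13 p.426 + p.398 (remark after (3.47)); Balaban1984PropagatorsII, (2.51) p.232 + Lemma 2.1 (2.60) p.234] -/
theorem c_letters_of_row26B (bg : MemberY d ℓ hd hL b₀ b₁ Mstar → B9.Backgrounds)
    (cfg : ∀ x : MemberY d ℓ hd hL b₀ b₁ Mstar, (bg x).Cfg → CfgY (Matrix (Fin N) (Fin N) ℂ) x.toKIdx)
    (Δ2 : ∀ x : MemberY d ℓ hd hL b₀ b₁ Mstar, BondOpY (Matrix (Fin N) (Fin N) ℂ) x.toKIdx)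
    {X Y W : MemberY d ℓ hd hL b₀ b₁ Mstar → Type} [∀ x, Fintype (X x)] [∀ x, Fintype (Y x)] [∀ x, Fintype (W x)]
    (𝔬 : ∀ x : MemberY d ℓ hd hL b₀ b₁ Mstar, Ops (geo9Y x) (bg x) (X x) (Y x) (XHK (TrIdx N) x.toKIdx) (W x))
    (H : MemberY d ℓ hd hL b₀ b₁ Mstar → Prop) {c35 : ℝ}
    (hblkZ : ∀ x, (𝔬 x).blkZ = blkHK x.toKIdx)
    (hC : ∀ x U, (𝔬 x).C U = CcoK x.toKIdx (trBasis N) (bg x) (cfg x) (parSymY x.toKIdx) (parBY x.toKIdx) (GpPhysY x.toKIdx (parSymY x.toKIdx)) U)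
    (hC1 : ∀ x U, (𝔬 x).C1 U = C1coK x.toKIdx (trBasis N) (bg x) (cfg x) (parSymY x.toKIdx) (parBY x.toKIdx) (GpPhysY x.toKIdx (parSymY x.toKIdx)) (Δ2 x) U)
    (hpl : ∀ (x : MemberY d ℓ hd hL b₀ b₁ Mstar) (y : (geo9Y x).Site), 0 ≤ ((((ℓ + 1 : ℕ) : ℝ) ^ (d + 1)) ^ lvl x.hN x.D x.hk y)⁻¹)
    (hpl' : ∀ (x : MemberY d ℓ hd hL b₀ b₁ Mstar) (y : (geo9Y x).Site), 0 ≤ (geo9Y x).len y * ((((ℓ + 1 : ℕ) : ℝ) ^ (d + 1)) ^ lvl x.hN x.D x.hk y)⁻¹)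
    (h26 : B9.Stmt3132Printed (d + 1) c35 (geo9Y (d := d) (ℓ := ℓ) (hd := hd) (hL := hL) (b₀ := b₀) (b₁ := b₁) (Mstar := Mstar)) bg
      (fun x => siteKernelOfOpNu x.toKIdx (bg x) (cfg x) (nuY (d + 1) x.toKIdx)
        (QGQinvY x.toKIdx (parSymY x.toKIdx) (parBY x.toKIdx) (GpPhysY x.toKIdx (parSymY x.toKIdx))))
      (fun x => siteKernelOfOpNu x.toKIdx (bg x) (cfg x) (nuY (d + 1) x.toKIdx)
        (QG1QinvY x.toKIdx (parSymY x.toKIdx) (parBY x.toKIdx) (GpPhysY x.toKIdx (parSymY x.toKIdx)) (Δ2 x)))) :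
    ∃ M₄ δC a₀ BC : ℝ, 0 < M₄ ∧ 0 < δC ∧ 0 < a₀ ∧ 0 < BC ∧
      ∀ x : MemberY d ℓ hd hL b₀ b₁ Mstar, M₄ ≤ (geo9Y x).M → ∀ α₀ : ℝ, 0 < α₀ → (geo9Y x).M * α₀ ≤ a₀ →
        ∀ U : (bg x).Cfg, (bg x).Reg335 c35 α₀ U → (bg x).Reg336 c35 α₀ U →
          HasMaj (cNorm 1 (H x) (𝔬 x).blkZ (fun y => (geo9Y_len_pos x y).le) 2)
              (weightNorm (BlockNorm.ofBlocks (toB6 (geo9Y x) 1 (H x)) (𝔬 x).blkZ)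
                (fun y => ((((ℓ + 1 : ℕ) : ℝ) ^ (d + 1)) ^ lvl x.hN x.D x.hk y)⁻¹) (hpl x))
              ((𝔬 x).C U) (fun a b => BC * Real.exp (-(δC * (geo9Y x).dist a b))) ∧
            HasMaj (cNorm 1 (H x) (𝔬 x).blkZ (fun y => (geo9Y_len_pos x y).le) 2)
              (weightNorm (BlockNorm.ofBlocks (toB6 (geo9Y x) 1 (H x)) (𝔬 x).blkZ)
                (fun y => ((((ℓ + 1 : ℕ) : ℝ) ^ (d + 1)) ^ lvl x.hN x.D x.hk y)⁻¹) (hpl x))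
              ((𝔬 x).C1 U) (fun a b => BC * Real.exp (-(δC * (geo9Y x).dist a b))) ∧
            HasMaj (cNorm 1 (H x) (𝔬 x).blkZ (fun y => (geo9Y_len_pos x y).le) 1)
              (weightNorm (BlockNorm.ofBlocks (toB6 (geo9Y x) 1 (H x)) (𝔬 x).blkZ)
                (fun y => (geo9Y x).len y * ((((ℓ + 1 : ℕ) : ℝ) ^ (d + 1)) ^ lvl x.hN x.D x.hk y)⁻¹) (hpl' x))
              ((𝔬 x).C1 U) (fun a b => BC * Real.exp (-(δC * (geo9Y x).dist a b))) := by
  obtain ⟨M₄, δ₁, a₀, C, hM₄, hδ₁, ha₀, hC0, hall⟩ := h26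
  have hK1 : (1 : ℝ) ≤ 2 * ((ℓ : ℝ) + 1) ^ 2 - 1 := by nlinarith [(Nat.cast_nonneg ℓ : (0 : ℝ) ≤ ℓ)]
  -- the class-reading threshold (gap δ₁/2) and the transfer threshold (ε = δ₁/4)
  set Kg : ℝ := (δ₁ - δ₁ / 2) * (2 * ((ℓ : ℝ) + 1) ^ 2 - 1) with hKg
  have hKg0 : 0 < Kg := mul_pos (by linarith) (by linarith)
  set Kt : ℝ := δ₁ / 4 * (2 * ((ℓ : ℝ) + 1) ^ 2 - 1) with hKt
  have hKt0 : 0 < Kt := mul_pos (by linarith) (by linarith)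
  set M₀ : ℝ := 2 * Real.log (((ℓ + 1 : ℕ) : ℝ)) / Kg with hM₀
  set M₀' : ℝ := 1 * Real.log (((ℓ + 1 : ℕ) : ℝ)) / Kt with hM₀'
  set A : ℝ := cR39 (trBasis N) * (coordBound39 (trBasis N) * basisBound39 (trBasis N)) * C * (((ℓ + 1 : ℕ) : ℝ)) ^ 2 with hA
  have hA0 : 0 ≤ A := by
    have h1 : 0 ≤ coordBound39 (trBasis N) := norm_nonneg _
    have h2 : 0 ≤ basisBound39 (trBasis N) := Finset.sum_nonneg fun _ _ => norm_nonneg _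
    have h3 := cR39_nonneg (trBasis N)
    positivity
  set BC : ℝ := A * (((ℓ + 1 : ℕ) : ℝ)) + 1 with hBC
  have hL1 : (1 : ℝ) ≤ ((ℓ + 1 : ℕ) : ℝ) := by exact_mod_cast Nat.succ_le_succ (Nat.zero_le ℓ)
  have hABC : A ≤ BC := by
    have h1 : A ≤ A * (((ℓ + 1 : ℕ) : ℝ)) := le_mul_of_one_le_right hA0 hL1
    linarith
  have hBC0 : 0 < BC := by positivity
  refine ⟨max M₄ (max M₀ M₀'), δ₁ / 4, a₀, BC, lt_max_of_lt_left hM₄, by positivity, ha₀, hBC0, fun x hM α₀ hα ha U hU hU' => ?_⟩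
  letI : Fintype (geo9K x.toKIdx).Site := (inferInstance : Fintype (geo9Y x).Site)
  have hgeo : GeoOK (geo9Y x) := ⟨geo9Y_dist_triangle x, geo9Y_dist_comm x, geo9K_dist_nonneg x.toKIdx, geo9Y_len_pos x⟩
  have hM4 : M₄ ≤ (geo9Y x).M := (le_max_left _ _).trans hM
  have hgap : 2 * Real.log (((ℓ + 1 : ℕ) : ℝ)) ≤ (δ₁ - δ₁ / 2) * (2 * ((ℓ : ℝ) + 1) ^ 2 - 1) * (geo9Y x).M := by
    have h0 : M₀ ≤ (geo9Y x).M := ((le_max_left _ _).trans (le_max_right _ _)).trans hM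
    rw [hM₀, div_le_iff₀ hKg0] at h0
    simpa [hKg, mul_comm, mul_left_comm, mul_assoc] using h0
  have hthr : (1 : ℝ) * Real.log (geo9K x.toKIdx).L ≤ δ₁ / 4 * (2 * ((ℓ : ℝ) + 1) ^ 2 - 1) * (geo9K x.toKIdx).M := by
    have h0 : M₀' ≤ (geo9Y x).M := ((le_max_right _ _).trans (le_max_right _ _)).trans hM
    rw [hM₀', div_le_iff₀ hKt0] at h0
    calc (1 : ℝ) * Real.log (geo9K x.toKIdx).L = 1 * Real.log (((ℓ + 1 : ℕ) : ℝ)) := rfl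
      _ ≤ (geo9Y x).M * Kt := h0
      _ = δ₁ / 4 * (2 * ((ℓ : ℝ) + 1) ^ 2 - 1) * (geo9K x.toKIdx).M := by rw [hKt]; show _ = _ * (geo9Y x).M; ring
  have hboth := hall x hM4 α₀ hα ha U hU hU'
  have hc2 := c2_pinsB x (B := bg x) (cfg := cfg x) (𝔬 := 𝔬 x) (H := H x) hC0.le (half_lt_self hδ₁) hgap le_rfl (hblkZ x) (hC x U) (hpl x) hboth.1
  have hc12 := c12_pinsB x (B := bg x) (cfg := cfg x) (𝔬 := 𝔬 x) (H := H x) hC0.le (half_lt_self hδ₁) hgap le_rfl (hblkZ x) (hC1 x U) (hpl x) hboth.2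
  have hδ' : δ₁ / 4 ≤ δ₁ / 2 - δ₁ / 4 := by linarith
  have hB' : A * (geo9K x.toKIdx).L ≤ BC := by show A * (((ℓ + 1 : ℕ) : ℝ)) ≤ BC; linarith
  have hc11 := c1_1_of_c1_2_transfer x.toKIdx hgeo (by positivity : (0 : ℝ) < δ₁ / 4) hthr
    (fun y => by positivity) (hpl' x) hA0 hB' hδ' hc12
  exact ⟨hasMaj_weaken hgeo hA0 hABC (by linarith : δ₁ / 4 ≤ δ₁ / 2) hc2, hasMaj_weaken hgeo hA0 hABC (by linarith : δ₁ / 4 ≤ δ₁ / 2) hc12, hc11⟩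

end Family

end Literature.MathematicalPhysics.QuantumFieldTheory.Balaban1983to89.B9LettersZCFieldsAtPinsB

end
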